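import Summits.KontsevichZagierPeriods.Zeta5Search.Certificates.RecordRayCoeffBound
import Summits.KontsevichZagierPeriods.Zeta5Search.Certificates.RecordRayCentreAsymp
import Summits.KontsevichZagierPeriods.Zeta5Search.Certificates.RecordRayPsiBound
import Summits.KontsevichZagierPeriods.Zeta5Search.Certificates.RecordRayGrowthUpper
import HarnessLib

/-!
# ζ(5) search — certificates: SHARP decay of the ζ(3)-coefficient on the record ray (cell `pub-zeta5`, cert-2 g2)

HONEST FRAMING: systematic search; no irrationality claim unless certified.

OUR work (Summit side; certifier 2, generation 2). Assembly of the two-heights Eisenstein bound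
(`RecordRayCoeffBound.coeffW_recordE_abs_le`: `|W| ≤ (e^{2π(6n+1)}S(3n+1) + e^{12πn}S(3n))/1000`,
`S(Y) = 3/2·√Mx(Y)·(20n+3)(20n+4)`), the asymptotic form of the centre value
(`RecordRayCentreAsymp.log_centre_record_le`: `log Mx(Y) ≤ −100·n log n + nΨ + 92 log(51n) + 40` for
`3n ≤ Y ≤ 3n+1`) and the certified constant (`RecordRayPsiBound.psi_explicit_le`: `Ψ ≤ −95.359`):

* `Mx_record_le_exp`  — `Mx e n Y ≤ exp(−100·n log n + nΨ + 92 log(51n) + 40)` (`e ≤ 1`, `n ≥ 1`, `3n ≤ Y ≤ 3n+1`);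
* `PsiRec_le`         — `Ψ ≤ −95359/1000`;
* `coeffW_recordE_exp_le` — **`|W(natB (41n) (BrecE e n))| ≤ exp(−50·n·log n − (499/50)·n + 48·log(51n) + 28)`**
  for all `n ≥ 1`, `e ≤ 1`; `coeffW_record_exp_le` — the same for `W(bRecord n)` and `W(bRecord' n)`.

The rate `−50 n log n − 9.98 n` is the SHARP one (`12π + Ψ/2 = −9.98038…`, numerically equal to the observed decay
`s₁ = −9.98190` of `W(b(a·n)) + 50 n log n` up to the continuum/lattice gap `0.0015`); the termwise (Cauchy) bound
would only give `−0.93 n`. This is the analytic half of hypothesis `(Hℓ)` of `RecordRay.record_exponent`: with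
`recordForm = ρ·(W(b′)F̃₇(b) − W(b)F̃₇(b′))` (`Certificates/RecordRayForms`), `log|ρ(a·n)| = 100 n log n + 139.556 n + o(n)`
and `log F̃₇ ≤ −50 n log n − (35.591 + 125.53) n + o(n)` it yields `ℓ = −31.55` (successor task: the Stirling
bookkeeping for `ρ` and `termNorm`, see cell CERTIFY-HOWTO §9 addendum 2).
-/

noncomputable section

open Finset Complex Filter Topology Real

namespace Summit.KontsevichZagierPeriods.Zeta5Search.RecordLine

open Summit.KontsevichZagierPeriods.Zeta5Search.DualSeries
open Summit.KontsevichZagierPeriods.Zeta5Search.DualSeriesBounds (natB)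
open Summit.KontsevichZagierPeriods.Zeta5Search.WedgeDictionary (coeffW coeffU)
open Summit.KontsevichZagierPeriods.Zeta5Search.DualPF
open Summit.KontsevichZagierPeriods.Zeta5Search.RecordRay (bRecord' eventually_log_linear_le)
open Summit.KontsevichZagierPeriods.Zeta5Search.DualSeriesLemma19 (bRecord)
open Summit.KontsevichZagierPeriods.Zeta5Search.LogEnclosures (psi_explicit_le)

/-! ### The centre value along the record ray -/

/-- `NSq = Nm/D` at any point of a line of positive height (`e ≤ 1`, `n ≥ 1`). -/
theorem NSq_eq_div {e n : ℕ} (he : e ≤ 1) (hn : 1 ≤ n) {Y : ℝ} (hY : 0 < Y) (x : ℝ) :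
    NSq e n Y x = Nm (41 * n) Y x / Dx (41 * n) (BrecE e n) Y x := by
  have h := normSq_Rc_mul (41 * n) (BrecE e n) (hreg_recE he hn) (x := x) hY.ne'
  rw [eq_div_iff (Dx_pos (41 * n) (BrecE e n) hY x).ne']
  unfold NSq
  exact h

/-- **`Mx ≤ exp(asymptotic bound)`**: for `e ≤ 1`, `n ≥ 1`, `3n ≤ Y ≤ 3n+1`,
`Mx e n Y ≤ exp(−100·n·log n + n·Ψ + 92·log(51n) + 40)`. -/
theorem Mx_record_le_exp {e n : ℕ} (he : e ≤ 1) (hn : 1 ≤ n) {Y : ℝ} (hY1 : 3 * (n : ℝ) ≤ Y)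
    (hY2 : Y ≤ 3 * n + 1) :
    Mx e n Y ≤ Real.exp (-100 * n * Real.log n + n * PsiRec + 92 * Real.log (51 * n) + 40) := by
  have hnR : (1 : ℝ) ≤ n := by exact_mod_cast hn
  have hY : 0 < Y := by linarith
  have key : ∀ s : ℝ, 0 ≤ s → s ≤ 1 / 2 →
      NSq e n Y (-1 - (41 * (n : ℝ) / 2 + s)) ≤
        Real.exp (-100 * n * Real.log n + n * PsiRec + 92 * Real.log (51 * n) + 40) := by
    intro s hs0 hs1
    have hpos : 0 < NSq e n Y (-1 - (41 * (n : ℝ) / 2 + s)) := by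
      rw [NSq_eq_div he hn hY]
      exact div_pos (Nm_pos _ hY _) (Dx_pos _ _ hY _)
    rw [← Real.exp_log hpos]
    apply Real.exp_le_exp.2
    rw [NSq_eq_div he hn hY]
    exact log_centre_record_le he hn hY1 hY2 hs0 hs1
  have e1 : (-((((41 * n : ℕ) : ℝ) + 2) / 2) : ℝ) = -1 - (41 * (n : ℝ) / 2 + 0) := by push_cast; ring
  have e2 : (-((((41 * n : ℕ) : ℝ) + 2) / 2) - 1 / 2 : ℝ) = -1 - (41 * (n : ℝ) / 2 + 1 / 2) := by push_cast; ring
  unfold Mx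
  rw [e2, e1]
  exact max_le (key 0 le_rfl (by norm_num)) (key (1 / 2) (by norm_num) le_rfl)

/-- **The certified constant**: `Ψ ≤ −95359/1000` (`RecordRayPsiBound.psi_explicit_le`, unfolded). -/
theorem PsiRec_le : PsiRec ≤ -(95359 / 1000 : ℝ) := by
  have h := psi_explicit_le
  unfold PsiRec Gam tauRec
  simp only [sum_range_succ, sum_range_zero]
  norm_num at h ⊢
  linarith

/-- `S_e(Y) ≤ exp(−50·n·log n + n·Ψ/2 + 48·log(51n) + 21)` for `3n ≤ Y ≤ 3n+1`
(`√Mx ≤ exp(half the bound)`, `(20n+3)(20n+4) ≤ (51n)²`, `3/2 ≤ e`). -/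
theorem SY_record_le_exp {e n : ℕ} (he : e ≤ 1) (hn : 1 ≤ n) {Y : ℝ} (hY1 : 3 * (n : ℝ) ≤ Y)
    (hY2 : Y ≤ 3 * n + 1) :
    SY e n Y ≤ Real.exp (-50 * n * Real.log n + n * PsiRec / 2 + 48 * Real.log (51 * n) + 21) := by
  have hnR : (1 : ℝ) ≤ n := by exact_mod_cast hn
  have hM := Mx_record_le_exp he hn hY1 hY2
  have hsqrt : Real.sqrt (Mx e n Y) ≤
      Real.exp ((-100 * n * Real.log n + n * PsiRec + 92 * Real.log (51 * n) + 40) / 2) := by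
    rw [Real.sqrt_le_left (by positivity), ← Real.exp_nat_mul]
    push_cast
    rw [show (2 : ℝ) * ((-100 * n * Real.log n + n * PsiRec + 92 * Real.log (51 * n) + 40) / 2)
      = -100 * n * Real.log n + n * PsiRec + 92 * Real.log (51 * n) + 40 by ring]
    exact hM
  have hpoly : ((20 : ℝ) * n + 3) * (20 * n + 4) ≤ Real.exp (2 * Real.log (51 * n)) := by
    rw [show (2 : ℝ) * Real.log (51 * n) = Real.log ((51 * n) ^ 2) by rw [Real.log_pow]; norm_num,
      Real.exp_log (by positivity)]
    nlinarith
  have h32 : (3 : ℝ) / 2 ≤ Real.exp 1 := by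
    have := Real.add_one_le_exp (1 : ℝ); linarith
  unfold SY
  calc 3 / 2 * (Real.sqrt (Mx e n Y) * ((20 * n + 3) * (20 * n + 4)))
      ≤ Real.exp 1 * (Real.exp ((-100 * n * Real.log n + n * PsiRec + 92 * Real.log (51 * n) + 40) / 2)
          * Real.exp (2 * Real.log (51 * n))) := by
        apply mul_le_mul h32 _ (by positivity) (by positivity)
        exact mul_le_mul hsqrt hpoly (by positivity) (by positivity)
    _ = Real.exp (-50 * n * Real.log n + n * PsiRec / 2 + 48 * Real.log (51 * n) + 21) := by
        rw [← Real.exp_add, ← Real.exp_add]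
        congr 1
        ring

/-- **SHARP COEFFICIENT DECAY on the record ray and its partner.** For `n ≥ 1`, `e ≤ 1`:
`|W(natB (41n) (BrecE e n))| ≤ exp(−50·n·log n − (499/50)·n + 48·log(51n) + 28)`
(`12π + Ψ/2 ≤ 37.699116 − 47.6795 = −9.98038 ≤ −9.98`). -/
theorem coeffW_recordE_exp_le {e n : ℕ} (he : e ≤ 1) (hn : 1 ≤ n) :
    |(coeffW (natB (41 * n) (BrecE e n)) : ℝ)| ≤
      Real.exp (-50 * n * Real.log n - 499 / 50 * n + 48 * Real.log (51 * n) + 28) := by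
  have hnR : (1 : ℝ) ≤ n := by exact_mod_cast hn
  have hW := coeffW_recordE_abs_le he hn
  have hS1 := SY_record_le_exp he hn (Y := 3 * n + 1) (by linarith) le_rfl
  have hS2 := SY_record_le_exp he hn (Y := 3 * n) le_rfl (by linarith)
  set B : ℝ := -50 * n * Real.log n + n * PsiRec / 2 + 48 * Real.log (51 * n) + 21 with hB
  have hpi := Real.pi_lt_d6
  have hpi0 := Real.pi_pos
  have hΨ := PsiRec_le
  -- both exponential prefactors are ≤ exp(12πn + 2π)
  have h1 : Real.exp (2 * π * (6 * n + 1)) ≤ Real.exp (12 * π * n + 2 * π) := by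
    apply Real.exp_le_exp.2; nlinarith
  have h2 : Real.exp (12 * π * n) ≤ Real.exp (12 * π * n + 2 * π) := by
    apply Real.exp_le_exp.2; nlinarith
  have hS0 : 0 ≤ SY e n (3 * n + 1) := SY_nonneg _ _ _
  have hS0' : 0 ≤ SY e n (3 * n) := SY_nonneg _ _ _
  have hsum : Real.exp (2 * π * (6 * n + 1)) * SY e n (3 * n + 1) + Real.exp (12 * π * n) * SY e n (3 * n)
      ≤ 2 * (Real.exp (12 * π * n + 2 * π) * Real.exp B) := by
    have a1 : Real.exp (2 * π * (6 * n + 1)) * SY e n (3 * n + 1) ≤ Real.exp (12 * π * n + 2 * π) * Real.exp B :=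
      mul_le_mul h1 hS1 hS0 (by positivity)
    have a2 : Real.exp (12 * π * n) * SY e n (3 * n) ≤ Real.exp (12 * π * n + 2 * π) * Real.exp B :=
      mul_le_mul h2 hS2 hS0' (by positivity)
    linarith
  have hfin : 2 * (Real.exp (12 * π * n + 2 * π) * Real.exp B) / 1000 ≤
      Real.exp (-50 * n * Real.log n - 499 / 50 * n + 48 * Real.log (51 * n) + 28) := by
    have hlt : 2 * (Real.exp (12 * π * n + 2 * π) * Real.exp B) / 1000 ≤
        Real.exp (12 * π * n + 2 * π) * Real.exp B := by
      have hp : 0 ≤ Real.exp (12 * π * n + 2 * π) * Real.exp B := by positivity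
      linarith
    refine hlt.trans ?_
    rw [← Real.exp_add]
    apply Real.exp_le_exp.2
    rw [hB]
    have hn0 : (0 : ℝ) ≤ n := by linarith
    have hrate : (12 * π + PsiRec / 2) * n ≤ -(499 / 50) * n :=
      mul_le_mul_of_nonneg_right (by linarith) hn0
    linarith
  exact hW.trans (le_trans (by linarith [hsum]) hfin)

/-- **SHARP COEFFICIENT DECAY, record ray and partner by name**: for `n ≥ 1`,
`|W(bRecord n)|, |W(bRecord' n)| ≤ exp(−50·n·log n − 9.98·n + 48·log(51n) + 28)`. -/
theorem coeffW_record_exp_le {n : ℕ} (hn : 1 ≤ n) :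
    |(coeffW (bRecord n) : ℝ)| ≤ Real.exp (-50 * n * Real.log n - 499 / 50 * n + 48 * Real.log (51 * n) + 28) ∧
    |(coeffW (bRecord' n) : ℝ)| ≤ Real.exp (-50 * n * Real.log n - 499 / 50 * n + 48 * Real.log (51 * n) + 28) := by
  rw [bRecord_eq, bRecord'_eq]
  exact ⟨coeffW_recordE_exp_le (Nat.zero_le 1) hn, coeffW_recordE_exp_le le_rfl hn⟩

/-- **SHARP COEFFICIENT DECAY, rate form**: for every `ε > 0`, eventually
`|W(bRecord n)|, |W(bRecord' n)| ≤ exp(−50·n·log n + (−9.98 + ε)·n)`. -/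
theorem eventually_coeffW_record_le_exp {ε : ℝ} (hε : 0 < ε) :
    ∀ᶠ n : ℕ in atTop,
      |(coeffW (bRecord n) : ℝ)| ≤ Real.exp (-50 * n * Real.log n + (-(499 / 50) + ε) * n) ∧
      |(coeffW (bRecord' n) : ℝ)| ≤ Real.exp (-50 * n * Real.log n + (-(499 / 50) + ε) * n) := by
  filter_upwards [eventually_ge_atTop 1,
    eventually_log_linear_le (a := 51) (b := 0) (by norm_num) le_rfl (show (0 : ℝ) < ε / 96 by positivity),
    tendsto_natCast_atTop_atTop.eventually_ge_atTop (56 / ε)] with n hn hlog hbig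
  have hb : (56 : ℝ) ≤ ε * n := by rwa [div_le_iff₀ hε, mul_comm] at hbig
  rw [add_zero] at hlog
  have hmono : Real.exp (-50 * n * Real.log n - 499 / 50 * n + 48 * Real.log (51 * n) + 28) ≤
      Real.exp (-50 * n * Real.log n + (-(499 / 50) + ε) * n) := by
    apply Real.exp_le_exp.2
    nlinarith
  obtain ⟨h0, h1⟩ := coeffW_record_exp_le hn
  exact ⟨h0.trans hmono, h1.trans hmono⟩

end Summit.KontsevichZagierPeriods.Zeta5Search.RecordLine
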